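import Summits.Ventures.HodgeKum4.Theorems.KummerFixedLocusSplit125
import Summits.Ventures.HodgeKum4.Theorems.KummerFixedLocusTransitiveTangent
import Literature.AlgebraicGeometry.HodgeTheory.DualLefschetzInLefschetzInvolutionAlgebraHolds
import HarnessLib

/-!
# Route `KummerFixedLocus`: the André input DISCHARGED — the closers of record with one binder fewer (cell `hodge-kum4`, seat p2 g8)

HONEST FRAMING.  Nothing here proves L1, I1geo, `HC_Kum4Type` or the Hodge conjecture outright.  Every theorem is
CONDITIONAL on the printed statements it names — named Literature facts taken as hypotheses — and, where stated,
on p1's cell lemma L1.  What changes with this file: the REFEREED input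
`HodgeTheory.Andre1996_dualLefschetz_mem_adjoin_lefschetzInvolution` (André 1996 §1.1–1.2 + Prop. 1.2 / Kleiman
1968, 1.4.4–1.4.6: the `sl₂`-partner `ᶜΛ` of a hard-Lefschetz class exists and lies in `ℂ[L, *_L]`), the binder
`hAn` of every landed closer of the route, is now a THEOREM of the tree —
`HodgeTheory.Andre1996_dualLefschetz_mem_adjoin_lefschetzInvolution_holds`
(`Literature/AlgebraicGeometry/HodgeTheory/DualLefschetzInLefschetzInvolutionAlgebraHolds`, p468064; kernel proof =
graded Jacobson–Morozov `Algebra/Lie/LefschetzModule` + Kleiman's polynomial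
`Algebra/Lie/LefschetzModuleStringReversal` + the Lefschetz-module transport
`Hyperkaehler/TotalCohomologyLefschetzModule`) — so each closer is restated with that binder SUPPLIED BY THE
THEOREM.  One-line applications; no new mathematics on this side.

WHAT IS PROVED (all CONDITIONAL on the remaining named facts):
* `gammaInvariantsDominatedKum4_of_facts'` — L2a′ from THREE printed facts (O'Grady–Markman–Voisin `J³`,
  Floccari–Fu, Foster `B(X)`; was four).
* `motivicBookkeepingKum4_of_facts_of_fixedLocus'` — L2 `MotivicBookkeepingKum4` (Summit-level node; the route item
  stmt-Ventures-19136 is its alias) from the same three facts and the route nodes F_Γ, F_Γ′, L3°.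
* `hc_kum4Type_of_L1_of_split125'` — **bill A‴ of record with FIFTEEN binders** = FOURTEEN named Literature facts
  (THIRTEEN REFEREED: O'Grady–Voisin, Floccari–Fu, Foster `B`, Hirzebruch `g`-signature, Floccari's fixed fourfold,
  Hodge index / Hodge–Riemann, Göttsche–Soergel `χ_y`, GKLR LLV-trivial classes, Foster's translation action,
  `|Γ| = 625`, Fulton's transversal pairing, `Γ ≅ (ℤ/5)⁴`, the tangent-dimension fact; ONE PRINT-SYNTHESIS: F125X)
  + L1 ⇒ `HC_Kum4Type ∧ HC_Kum4TypePowers` (was sixteen binders, p451323).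
* `hc_kum4Type_of_L1_of_tangentFixed''` — the alternative bill A′ with SIXTEEN binders (was seventeen, p442732).
* `kum4NonInvariantClassesAlgebraic_of_L1_of_split125` is NOT restated: L3° never used André.
Rung currency (the cell's words are the director's, not this file's): the count of named print inputs of the
by-name closer of record drops from 15 to 14 (13 REFEREED + F125X) + L1; open mathematics unchanged
(`{MODEL_X computed clause (19267)}`).
-/

noncomputable section

open CategoryTheory CategoryTheory.Limits MonoidalCategory
open Literature.AlgebraicGeometry Literature.AlgebraicGeometry.Motives
open Literature.AlgebraicGeometry.Hyperkaehler Literature.AlgebraicGeometry.GroupActions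
open Literature.AlgebraicGeometry.HodgeTheory

namespace Summit.Ventures.HodgeKum4

/-- **L2a′ `GammaInvariantsDominatedKum4` from THREE printed facts** (O'Grady–Markman–Voisin `J³`, Floccari–Fu,
Foster `B(X)` — REFEREED named facts): `gammaInvariantsDominatedKum4_of_facts` with its André binder supplied by
the tree theorem `Andre1996_dualLefschetz_mem_adjoin_lefschetzInvolution_holds`.  CONDITIONAL on the three. -/
theorem gammaInvariantsDominatedKum4_of_facts'
    (hOGV : OGradyVoisin2022_thirdJacobian_kugaSatake_kummerType)
    (hFF : FloccariFu2026_hodgeClasses_algebraic_powers_discOneWeilFourfold)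
    (hFo : Foster2024_lefschetzStandard_kummerType_prime) :
    Summit.Ventures.HodgeKum4.GammaInvariantsDominatedKum4 :=
  gammaInvariantsDominatedKum4_of_facts hOGV hFF hFo Andre1996_dualLefschetz_mem_adjoin_lefschetzInvolution_holds

/-- **L2 `MotivicBookkeepingKum4` (the Summit-level node; route item stmt-Ventures-19136 is its by-name alias) from
THREE printed facts and the route nodes F_Γ, F_Γ′, L3°** — `motivicBookkeepingKum4_of_facts_of_fixedLocus` with the
André binder supplied by the tree theorem.  CONDITIONAL on the three facts and the three nodes.  (Stated on the
Summit-level decl so that this file stays outside the route file's import cone.) -/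
theorem motivicBookkeepingKum4_of_facts_of_fixedLocus'
    (hOGV : OGradyVoisin2022_thirdJacobian_kugaSatake_kummerType)
    (hFF : FloccariFu2026_hodgeClasses_algebraic_powers_discOneWeilFourfold)
    (hFo : Foster2024_lefschetzStandard_kummerType_prime)
    (hΓ : Kum4TranslationGroup) (hoff : Kum4TranslationGroupTrivialOffMiddle)
    (h₃ : Kum4NonInvariantClassesAlgebraic) :
    Summit.Ventures.HodgeKum4.MotivicBookkeepingKum4 :=
  motivicBookkeepingKum4_of_facts_of_fixedLocus hOGV hFF hFo
    Andre1996_dualLefschetz_mem_adjoin_lefschetzInvolution_holds hΓ hoff h₃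

/-- **Bill A‴ of record with FIFTEEN binders: H3 for `Kum⁴`-type and its powers from FOURTEEN NAMED FACTS + L1** —
THIRTEEN REFEREED named facts (the eleven non-André facts of `hc_kum4Type_of_L1_of_meetsTranslates`, `Γ ≅ (ℤ/5)⁴`,
the tangent-dimension fact), ONE PRINT-SYNTHESIS named fact (F125X:
`HassettTschinkel2013_Oguiso2020_fixedPointScheme_translation_kum4Type`) and p1's cell lemma L1
`LefschetzGenerationKum4`; the André binder of `hc_kum4Type_of_L1_of_split125` (p451323) is supplied by the tree
theorem `Andre1996_dualLefschetz_mem_adjoin_lefschetzInvolution_holds`.  NO transport (T), NO Kummer-point input,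
NO (H2).  CONDITIONAL on all fifteen; nothing here says `HC_Kum4Type` or the Hodge conjecture is proved outright. -/
theorem hc_kum4Type_of_L1_of_split125'
    (hOGV : OGradyVoisin2022_thirdJacobian_kugaSatake_kummerType)
    (hFF : FloccariFu2026_hodgeClasses_algebraic_powers_discOneWeilFourfold)
    (hFo : Foster2024_lefschetzStandard_kummerType_prime)
    (hA1 : Hirzebruch1969_gSignature_involution_halfDimFixedLocus)
    (hA2 : Floccari2026_fixedFourfold_kum4Type)
    (hHIR : Voisin2002_hodgeIndex_hodgeRiemann_middle)
    (hGS : GoettscheSoergel1993_chiY_kum4Type)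
    (hGK : GreenKimLazaRobles2022_llvTrivial_isOfHodgeType_kumType)
    (hF : Foster2024_translationAction_kum4Type)
    (hcardF : Floccari2026_card_autFixingH2H3_kum4Type)
    (hFu : Fulton1998_cupPairing_transversalPoint)
    (hFV : FloccariVaresco2024_autFixingH2H3_equiv_kumType)
    (hTan : GroupActions.Milne2017_fixedComponent_dim_eq_finrank_tangentFixed)
    (h125 : HassettTschinkel2013_Oguiso2020_fixedPointScheme_translation_kum4Type)
    (hL1 : LefschetzGenerationKum4) :
    Summit.Ventures.HodgeKum4.HC_Kum4Type ∧ Summit.Ventures.HodgeKum4.HC_Kum4TypePowers :=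
  hc_kum4Type_of_L1_of_split125 hOGV hFF hFo Andre1996_dualLefschetz_mem_adjoin_lefschetzInvolution_holds hA1 hA2
    hHIR hGS hGK hF hcardF hFu hFV hTan h125 hL1

/-- **Bill A′ with SIXTEEN binders: H3 for `Kum⁴`-type and its powers from REFEREED PRINT + the transport synthesis
(T) + L1** — `hc_kum4Type_of_L1_of_tangentFixed'` (p442732) with its André binder supplied by the tree theorem:
fifteen printed statements (fourteen refereed: the ten non-André facts of `hc_kum4Type_of_L1_of_meetsTranslates`,
`Γ ≅ (ℤ/5)⁴`, Oguiso's split fixed points, the tangent-dimension fact, `|Γ| = 625` among them; one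
print-synthesis: the cohomological transport (T)) and L1.  CONDITIONAL on all sixteen; nothing here says
`HC_Kum4Type` or the Hodge conjecture is proved outright. -/
theorem hc_kum4Type_of_L1_of_tangentFixed''
    (hOGV : OGradyVoisin2022_thirdJacobian_kugaSatake_kummerType)
    (hFF : FloccariFu2026_hodgeClasses_algebraic_powers_discOneWeilFourfold)
    (hFo : Foster2024_lefschetzStandard_kummerType_prime)
    (hA1 : Hirzebruch1969_gSignature_involution_halfDimFixedLocus)
    (hA2 : Floccari2026_fixedFourfold_kum4Type)
    (hHIR : Voisin2002_hodgeIndex_hodgeRiemann_middle)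
    (hGS : GoettscheSoergel1993_chiY_kum4Type)
    (hGK : GreenKimLazaRobles2022_llvTrivial_isOfHodgeType_kumType)
    (hF : Foster2024_translationAction_kum4Type)
    (hcardF : Floccari2026_card_autFixingH2H3_kum4Type)
    (hFu : Fulton1998_cupPairing_transversalPoint)
    (hFV : FloccariVaresco2024_autFixingH2H3_equiv_kumType)
    (hTr : HassettTschinkel2013_Floccari2026_fixedFourfoldClass_transport_kum4Type)
    (hOg : Oguiso2020_fixedPointScheme_translation_generalizedKummerFour)
    (hTan : GroupActions.Milne2017_fixedComponent_dim_eq_finrank_tangentFixed)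
    (hL1 : LefschetzGenerationKum4) :
    Summit.Ventures.HodgeKum4.HC_Kum4Type ∧ Summit.Ventures.HodgeKum4.HC_Kum4TypePowers :=
  hc_kum4Type_of_L1_of_tangentFixed' hOGV hFF hFo Andre1996_dualLefschetz_mem_adjoin_lefschetzInvolution_holds hA1
    hA2 hHIR hGS hGK hF hcardF hFu hFV hTr hOg hTan hL1

end Summit.Ventures.HodgeKum4

end
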